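import Summits.CriticalPhenomena.PercolationContinuityZ3.Theorems.Transplant.HornBlocks
import HarnessLib

/-!
# GLUING GOOD BLOCKS OF THE HORN: anchors, good coarse edges as open paths of `ℤ³`, seed uniqueness in thin and thick slab pieces

builds on p205010 (kernel theorem, internal audit signed; external expert review pending) — NOT used in this file.
Lane `prim-bschramm`, seat `prim-bschramm-p2` (gen 25; class C1b; memo `HOME/bschramm/P2-LATTICES.md` §90, the HORN PROGRAMME, file B1c-1);
helper file (`--supports stmt-CriticalPhenomena-4575 --as helper`).

The deterministic interface between the ambient events of `HornBlocks` and open paths of `ℤ³` (for lattice configurations `ω ⊆ E(ℤ³)`):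
(§1) TRANSPORT along an injective `f : W → V`: `restrictConfig f ω ∈ openConnIn S x y ↔ ω ∈ openConnIn (f '' S) (f x) (f y)`
(`openConnIn_image_iff`); (§2) the slab-piece columns `col K s B = emb K s '' \overline{B}` and their inclusions `Σ_i, Σ_{i+1} ⊆ Θ_i`;
(§3) ANCHORS: `b ∈ anchors K s n u w ω` — `b` lies in the seed column `col K s (w + B_u)` and is joined inside `col K s (w + B_{3n})` to its boundary column;
(§4) THE THREE MECHANISMS: a good coarse edge `{z, z + e_j}` of `Σ_i` yields anchored points `a` at `z`, `b` at `z + e_j` joined inside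
`col_i(R)` (`exists_anchors_of_edgeGood`, DST's good edge + boundary entry); two points anchored at the same block of `Σ_i` are joined inside its
`3n`-column (`conn_of_anchored`, DST's seed uniqueness); two points anchored at the same planar block in `Σ_i` and `Σ_{i+1}` are joined inside the
thick column of `Θ_i` (`conn_of_anchored_thick`, seed uniqueness in `S_{2k+1}`).  The chaining along `★`-paths of good sites is the next file.
[cite: DuminilCopinSidoraviciusTassion2016, §2.1 (display before eq. (13)), §2.2] [cite: GrimmettPercolation1999, §7.4 p. 182]
-/

noncomputable section

namespace Summit.CriticalPhenomena.PercolationContinuityZ3.Theorems.Transplant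

namespace HornGluing

open Literature.Probability.Percolation Literature.Probability.LatticeModels HornBlocks

/-! ## §1 Transport of open paths along an injective vertex map -/

/-- **Open paths of the restricted configuration are open paths** inside the image set. [folklore] -/
theorem openConnIn_image_of_restrict {V W : Type*} {f : W → V} (hf : Function.Injective f) {ω : BondConfig V} {S : Set W} {x y : W}
    (h : restrictConfig f ω ∈ openConnIn S x y) : ω ∈ openConnIn (f '' S) (f x) (f y) := by
  rw [mem_openConnIn_iff_pathIn] at h ⊢
  obtain ⟨hx, hchain⟩ := h
  refine ⟨⟨x, hx, rfl⟩, ?_⟩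
  induction hchain with
  | refl => exact Relation.ReflTransGen.refl
  | @tail b c _ hbc ih =>
    refine ih.tail ⟨?_, ⟨c, hbc.2, rfl⟩⟩
    have h1 := (openGraph_adj _ b c).1 hbc.1
    exact (openGraph_adj ω (f b) (f c)).2 ⟨by simpa [Sym2.map_mk] using h1.1, hf.ne h1.2⟩

/-- **Open paths inside an image set lift to the restricted configuration.** [folklore] -/
theorem openConnIn_restrict_of_image {V W : Type*} {f : W → V} (hf : Function.Injective f) {ω : BondConfig V} {S : Set W} {x y : W}
    (h : ω ∈ openConnIn (f '' S) (f x) (f y)) : restrictConfig f ω ∈ openConnIn S x y := by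
  rw [mem_openConnIn_iff_pathIn] at h ⊢
  obtain ⟨hx, hchain⟩ := h
  obtain ⟨x', hx', hxx'⟩ := hx
  have hxS : x ∈ S := by rwa [← hf hxx']
  have key : ∀ v, Relation.ReflTransGen (fun a b => (openGraph ω).Adj a b ∧ b ∈ f '' S) (f x) v →
      ∃ w, f w = v ∧ Relation.ReflTransGen (fun a b => (openGraph (restrictConfig f ω)).Adj a b ∧ b ∈ S) x w := by
    intro v hv
    induction hv with
    | refl => exact ⟨x, rfl, Relation.ReflTransGen.refl⟩
    | @tail b c _ hbc ih =>
      obtain ⟨w, hw, hxw⟩ := ih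
      obtain ⟨c', hc'S, hc'⟩ := hbc.2
      refine ⟨c', hc', hxw.tail ⟨?_, hc'S⟩⟩
      have h1 := (openGraph_adj ω b c).1 hbc.1
      subst hw; subst hc'
      exact (openGraph_adj _ w c').2 ⟨by simpa [Sym2.map_mk] using h1.1, fun h => h1.2 (congrArg f h)⟩
  obtain ⟨w, hw, hxw⟩ := key _ hchain
  obtain rfl : w = y := hf hw
  exact ⟨hxS, hxw⟩

/-- **Transport, both ways.** [folklore] -/
theorem openConnIn_image_iff {V W : Type*} {f : W → V} (hf : Function.Injective f) (ω : BondConfig V) (S : Set W) (x y : W) :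
    restrictConfig f ω ∈ openConnIn S x y ↔ ω ∈ openConnIn (f '' S) (f x) (f y) :=
  ⟨openConnIn_image_of_restrict hf, openConnIn_restrict_of_image hf⟩

/-- A lattice configuration of `ℤ³` restricts to a lattice configuration of the slab piece. [folklore] -/
theorem restrict_subset_edgeSet {ω : BondConfig (Site 3)} (hω : ω ⊆ (zdGraph 3).edgeSet) (K : ℕ) (s : ℤ) :
    restrictConfig (emb K s) ω ⊆ (slabGraph 3 K).edgeSet := by
  intro e he
  induction e using Sym2.ind with
  | h a b =>
    rw [mem_restrictConfig, Sym2.map_mk] at he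
    have hadj := (SimpleGraph.mem_edgeSet _).1 (hω he)
    rw [SimpleGraph.mem_edgeSet, ← comap_emb K s]
    exact hadj

/-! ## §2 Columns of slab pieces -/

/-- The column of the slab piece at height `s` (thickness `K`) over the planar set `B`: `emb K s '' \overline{B}`. [folklore] -/
def col (K : ℕ) (s : ℤ) (B : Set (ℤ × ℤ)) : Set (Site 3) := emb K s '' slabLift K B

/-- Membership in a column: `x ∈ col K s B ↔ s ≤ x₀ ≤ s + K ∧ (x₁, x₂) ∈ B`. [folklore] -/
theorem mem_col {K : ℕ} {s : ℤ} {B : Set (ℤ × ℤ)} {x : Site 3} :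
    x ∈ col K s B ↔ s ≤ x 0 ∧ x 0 ≤ s + K ∧ ((x 1, x 2) : ℤ × ℤ) ∈ B := by
  constructor
  · rintro ⟨y, hy, rfl⟩
    obtain ⟨e0, e1, e2⟩ := emb_apply K s y
    have hy0 : 0 ≤ (y : Site 3) 0 ∧ (y : Site 3) 0 ≤ (K : ℤ) := y.2
    rw [e0, e1, e2]
    exact ⟨by omega, by omega, by simpa [mem_slabLift_iff, planar] using hy⟩
  · rintro ⟨h1, h2, h3⟩
    refine ⟨⟨![x 0 - s, x 1, x 2], ⟨by simp; omega, by simp; omega⟩⟩, by simpa [mem_slabLift_iff, planar] using h3, ?_⟩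
    ext i; fin_cases i <;> simp [emb]

/-- Columns are monotone in the planar set. [folklore] -/
theorem col_mono {K : ℕ} {s : ℤ} {B B' : Set (ℤ × ℤ)} (h : B ⊆ B') : col K s B ⊆ col K s B' := by
  intro x hx; rw [mem_col] at hx ⊢; exact ⟨hx.1, hx.2.1, h hx.2.2⟩

/-- **`Σ_i ⊆ Θ_i`**: the thin column at height `hgt k i` lies in the thick one. [folklore] -/
theorem col_subset_thick (k : ℕ) (i : ℤ) (B : Set (ℤ × ℤ)) : col k (hgt k i) B ⊆ col (2 * k + 1) (hgt k i) B := by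
  intro x hx; rw [mem_col] at hx ⊢; refine ⟨hx.1, ?_, hx.2.2⟩; push_cast; omega

/-- **`Σ_{i+1} ⊆ Θ_i`**: the thin column at height `hgt k (i+1)` lies in the thick one at height `hgt k i`. [folklore] -/
theorem col_succ_subset_thick (k : ℕ) (i : ℤ) (B : Set (ℤ × ℤ)) : col k (hgt k (i + 1)) B ⊆ col (2 * k + 1) (hgt k i) B := by
  intro x hx; rw [mem_col] at hx ⊢
  have e : hgt k (i + 1) = hgt k i + (k + 1) := by simp only [hgt]; ring
  rw [e] at hx
  refine ⟨?_, ?_, hx.2.2⟩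
  · have : (0 : ℤ) ≤ k := Nat.cast_nonneg k
    omega
  · push_cast; omega

/-! ## §3 Anchored points -/

/-- **`b` is anchored at the block of planar centre `w` of the slab piece `(K, s)`**: `b` lies in the seed column `col K s (w + B_u)` and is joined by an
open path inside the column `col K s (w + B_{3n})` to a point of the boundary column `col K s (w + ∂B_{3n})`.
[cite: DuminilCopinSidoraviciusTassion2016, §2.1 (S ⟷ ∂B_n)] -/
def anchors (K : ℕ) (s : ℤ) (n u : ℕ) (w : ℤ × ℤ) (ω : BondConfig (Site 3)) : Set (Site 3) :=
  {b | b ∈ col K s (sqBox w u) ∧ ∃ e ∈ col K s (sqSphere w (3 * n)), ω ∈ openConnIn (col K s (sqBox w (3 * n))) b e}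

/-- Anchors pass from `Σ_i` to `Θ_i`. [folklore] -/
theorem anchors_thick {k n u : ℕ} {i : ℤ} {w : ℤ × ℤ} {ω : BondConfig (Site 3)} {b : Site 3} (h : b ∈ anchors k (hgt k i) n u w ω) :
    b ∈ anchors (2 * k + 1) (hgt k i) n u w ω := by
  obtain ⟨hb, e, he, hbe⟩ := h
  exact ⟨col_subset_thick k i _ hb, e, col_subset_thick k i _ he, openConnIn_mono (col_subset_thick k i _) _ _ hbe⟩

/-- Anchors pass from `Σ_{i+1}` to `Θ_i`. [folklore] -/
theorem anchors_thick_succ {k n u : ℕ} {i : ℤ} {w : ℤ × ℤ} {ω : BondConfig (Site 3)} {b : Site 3}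
    (h : b ∈ anchors k (hgt k (i + 1)) n u w ω) : b ∈ anchors (2 * k + 1) (hgt k i) n u w ω := by
  obtain ⟨hb, e, he, hbe⟩ := h
  exact ⟨col_succ_subset_thick k i _ hb, e, col_succ_subset_thick k i _ he,
    openConnIn_mono (col_succ_subset_thick k i _) _ _ hbe⟩

/-- **Slab-level anchors give ambient anchors**: a slab point `b ∈ \overline{w + B_u}` joined inside `\overline{w + B_{3n}}` to `\overline{w + ∂B_{3n}}` in the
restricted configuration is anchored in `ℤ³`. [folklore] -/
theorem anch_of_slab {K : ℕ} {s : ℤ} {n u : ℕ} {w : ℤ × ℤ} {ω : BondConfig (Site 3)} {b e : slab 3 K}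
    (hb : b ∈ slabLift K (sqBox w u)) (he : e ∈ slabLift K (sqSphere w (3 * n)))
    (hbe : restrictConfig (emb K s) ω ∈ openConnIn (slabLift K (sqBox w (3 * n))) b e) : emb K s b ∈ anchors K s n u w ω :=
  ⟨⟨b, hb, rfl⟩, emb K s e, ⟨e, he, rfl⟩, openConnIn_image_of_restrict (emb_injective K s) hbe⟩

/-! ## §4 The three mechanisms -/

/-- The planar centre of `z + e_j` is `4n z + 4n e_j`. [folklore] -/
theorem ctr_add_cstep (n : ℕ) (z : ℤ × ℤ) (j : Fin 2) : ctr n (z + cstep j) = ctr n z + coarseShift (4 * n) j := by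
  fin_cases j <;> simp [ctr, cstep, coarseShift] <;> ring

/-- **A good coarse edge yields two anchored points joined inside its rectangle column**: if `ω ∈ edgeGood k n u i z j` (`u ≤ n`, `ω` a lattice
configuration) there are `a` anchored at `z` and `b` anchored at `z + e_j` in `Σ_i` with `a ↔ b` inside `col_i(4nz + 2n e_j + B_{6n})`.
[cite: DuminilCopinSidoraviciusTassion2016, §2.2 (definition of a good edge), §2.1] -/
theorem exists_anchors_of_edgeGood {k n u : ℕ} (hu : u ≤ n) {i : ℤ} {z : ℤ × ℤ} {j : Fin 2} {ω : BondConfig (Site 3)}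
    (hω : ω ⊆ (zdGraph 3).edgeSet) (h : ω ∈ edgeGood k n u i z j) :
    ∃ a b : Site 3, a ∈ anchors k (hgt k i) n u (ctr n z) ω ∧ b ∈ anchors k (hgt k i) n u (ctr n (z + cstep j)) ω ∧
      ω ∈ openConnIn (col k (hgt k i) (sqBox (ctr n z + coarseShift (2 * n) j) (6 * n))) a b := by
  set ρ := restrictConfig (emb k (hgt k i)) ω with hρ
  have hρE : ρ ⊆ (slabGraph 3 k).edgeSet := restrict_subset_edgeSet hω k _
  obtain ⟨⟨a, ha, b, hb, hab⟩, -, -⟩ := h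
  have hsph := sqBox_shift_inter_subset_sqSphere hu (ctr n z) j
  -- `b` is anchored at `z + e_j`: follow the path `a → b` backwards? No: enter the box of `z + e_j` from `a`.
  obtain ⟨e, he, hbe⟩ := exists_sqSphere_openConnIn k hρE hab
    (slabLift_mono k ((sqBox_mono _ (by omega : u ≤ 3 * n))) hb) (fun haB => hsph.2 ⟨ha, haB⟩)
  -- `a` is anchored at `z`: enter the box of `z` from `b`
  obtain ⟨e', he', hae'⟩ := exists_sqSphere_openConnIn k hρE (openConnIn_reverse hab)
    (slabLift_mono k ((sqBox_mono _ (by omega : u ≤ 3 * n))) ha) (fun hbB => hsph.1 ⟨hb, hbB⟩)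
  refine ⟨emb k (hgt k i) a, emb k (hgt k i) b, anch_of_slab ha he' hae', ?_, openConnIn_image_of_restrict (emb_injective k _) hab⟩
  rw [ctr_add_cstep]
  exact anch_of_slab hb he hbe

/-- **Seed uniqueness in `Σ_i`**: if `ω ∈ edgeGood k n u i z j` then any two points anchored at `z` in `Σ_i` are joined inside the column
`col_i(4nz + B_{3n})`. [cite: DuminilCopinSidoraviciusTassion2016, §2.1 (S ⟷^{!B!} ∂B), §2.2] -/
theorem conn_of_anchored {k n u : ℕ} {i : ℤ} {z : ℤ × ℤ} {j : Fin 2} {ω : BondConfig (Site 3)} (h : ω ∈ edgeGood k n u i z j)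
    {b b' : Site 3} (hb : b ∈ anchors k (hgt k i) n u (ctr n z) ω) (hb' : b' ∈ anchors k (hgt k i) n u (ctr n z) ω) :
    ω ∈ openConnIn (col k (hgt k i) (sqBox (ctr n z) (3 * n))) b b' := by
  obtain ⟨-, hU, -⟩ := h
  obtain ⟨⟨y, hy, rfl⟩, e, ⟨f, hf, rfl⟩, hbe⟩ := hb
  obtain ⟨⟨y', hy', rfl⟩, e', ⟨f', hf', rfl⟩, hbe'⟩ := hb'
  have h1 := openConnIn_restrict_of_image (emb_injective k _) hbe
  have h2 := openConnIn_restrict_of_image (emb_injective k _) hbe'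
  exact openConnIn_image_of_restrict (emb_injective k _) (hU.2 y hy y' hy' f hf f' hf' h1 h2)

/-- Seed uniqueness at the far endpoint `z + e_j` of a good coarse edge. [cite: DuminilCopinSidoraviciusTassion2016, §2.2] -/
theorem conn_of_anchored' {k n u : ℕ} {i : ℤ} {z : ℤ × ℤ} {j : Fin 2} {ω : BondConfig (Site 3)} (h : ω ∈ edgeGood k n u i z j)
    {b b' : Site 3} (hb : b ∈ anchors k (hgt k i) n u (ctr n (z + cstep j)) ω) (hb' : b' ∈ anchors k (hgt k i) n u (ctr n (z + cstep j)) ω) :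
    ω ∈ openConnIn (col k (hgt k i) (sqBox (ctr n (z + cstep j)) (3 * n))) b b' := by
  obtain ⟨-, -, hU⟩ := h
  rw [ctr_add_cstep] at hb hb' ⊢
  obtain ⟨⟨y, hy, rfl⟩, e, ⟨f, hf, rfl⟩, hbe⟩ := hb
  obtain ⟨⟨y', hy', rfl⟩, e', ⟨f', hf', rfl⟩, hbe'⟩ := hb'
  have h1 := openConnIn_restrict_of_image (emb_injective k _) hbe
  have h2 := openConnIn_restrict_of_image (emb_injective k _) hbe'
  exact openConnIn_image_of_restrict (emb_injective k _) (hU.2 y hy y' hy' f hf f' hf' h1 h2)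

/-- **Seed uniqueness in the thick piece `Θ_i`**: if `ω ∈ thickGood k n u i z` then any two points anchored at `z` in `Θ_i` — in particular one anchored in
`Σ_i` and one in `Σ_{i+1}` — are joined inside the thick column `col_{Θ_i}(4nz + B_{3n})`. [cite: DuminilCopinSidoraviciusTassion2016, §2.1 eq. (1)] -/
theorem conn_of_anchored_thick {k n u : ℕ} {i : ℤ} {z : ℤ × ℤ} {ω : BondConfig (Site 3)} (h : ω ∈ thickGood k n u i z)
    {b b' : Site 3} (hb : b ∈ anchors (2 * k + 1) (hgt k i) n u (ctr n z) ω) (hb' : b' ∈ anchors (2 * k + 1) (hgt k i) n u (ctr n z) ω) :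
    ω ∈ openConnIn (col (2 * k + 1) (hgt k i) (sqBox (ctr n z) (3 * n))) b b' := by
  have hU : restrictConfig (emb (2 * k + 1) (hgt k i)) ω ∈
      slabUniqueConn (2 * k + 1) (sqBox (ctr n z) (3 * n)) (sqBox (ctr n z) u) (sqSphere (ctr n z) (3 * n)) := h
  obtain ⟨⟨y, hy, rfl⟩, e, ⟨f, hf, rfl⟩, hbe⟩ := hb
  obtain ⟨⟨y', hy', rfl⟩, e', ⟨f', hf', rfl⟩, hbe'⟩ := hb'
  have h1 := openConnIn_restrict_of_image (emb_injective _ _) hbe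
  have h2 := openConnIn_restrict_of_image (emb_injective _ _) hbe'
  exact openConnIn_image_of_restrict (emb_injective _ _) (hU.2 y hy y' hy' f hf f' hf' h1 h2)

/-- **Vertical gluing**: a point anchored at `z` in `Σ_i` and a point anchored at `z` in `Σ_{i+1}` are joined inside the thick column of `Θ_i` when
`ω ∈ thickGood k n u i z`. [cite: DuminilCopinSidoraviciusTassion2016, §2.1 eq. (1)] -/
theorem conn_vertical {k n u : ℕ} {i : ℤ} {z : ℤ × ℤ} {ω : BondConfig (Site 3)} (h : ω ∈ thickGood k n u i z)
    {b b' : Site 3} (hb : b ∈ anchors k (hgt k i) n u (ctr n z) ω) (hb' : b' ∈ anchors k (hgt k (i + 1)) n u (ctr n z) ω) :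
    ω ∈ openConnIn (col (2 * k + 1) (hgt k i) (sqBox (ctr n z) (3 * n))) b b' :=
  conn_of_anchored_thick h (anchors_thick hb) (anchors_thick_succ hb')

end HornGluing

end Summit.CriticalPhenomena.PercolationContinuityZ3.Theorems.Transplant

end
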